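import Summits.ResolutionOfSingularities.ResolutionOfSingularities.Theorems.FrobeniusLadderFInjectiveMacaulayficationTauFloorBTChart
import Summits.ResolutionOfSingularities.ResolutionOfSingularities.Theorems.FrobeniusLadderFInjectiveMacaulayficationReesChartFacts
import Literature.AlgebraicGeometry.Resolution.AffineBlowupAlgebra
import HarnessLib

/-!
# (O-1′-X) The chart `D(x̄²)` of `Bl_τ(P2d5C)` is the MONIC HYPERSURFACE `C_X = k[x, y′, u′, t′, s′][z′]/(z′² + x²z′ + x²(y′³+u′³+t′³+s′³))`: CM at every prime and
# `C_X ≃+* A₀[τ/x̄²] = blowupAlgebra τ (x̄²)`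
# (crux `FInjectiveMacaulayfication` stmt-ResolutionOfSingularities-15315, chain w45a; res-L1-w45a-plan-1 g19 RULING R19.15 «(O-1′) the FIRST d = 5 kernel row, input side → stub-1»,
# legal side, chart `D(x̄²)`; method of res-L1-w45a-stub-2's `…TauFloorBTChart` (p637291) one dimension up; seat res-L1-w45a-stub-1 g11)

[OURS · L1 W4.5a] Support file (`--supports stmt-ResolutionOfSingularities-15315 --as helper`); replaces the role of NO printed item; NOT a statement of
any manuscript; def-free (the chart polynomial is a hypothesis `g₀` with its defining equation); UNCONDITIONAL; characteristic-free. AI-written (AI review is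
weaker than expert review).

`A₀ = k[X0..X5]/(f)`, `f = X5² + X0⁴X5 + X1³ + X2³ + X3³ + X4³` (P2d5C; `x,y,u,t,s,z = X0..X5`), `τ = Ideal.span {x̄², ȳ, ū, t̄, s̄, z̄}`. On `D(x̄²)`: `y = x²y′`,
`u = x²u′`, `t = x²t′`, `s = x²s′`, `z = x²z′` and `f = x⁴·(z′² + x²z′ + x²(y′³+u′³+t′³+s′³))`, so the chart ring is `C_X = AdjoinRoot g₀`,
`g₀ = Z² + (C(X0²)·Z + C(X0²(X1³+X2³+X3³+X4³)))` over `B₀ = k[X0..X4]` (`X0 = x`, `X1 = y′`, `X2 = u′`, `X3 = t′`, `X4 = s′`) — MONIC, hence free and finite over `B₀`.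
* §1 `monic_g₀`, `free_finite`, ★ `cmCl_localization` (ONE `exact` over `FlatIntegralCM.cmCl_localization_of_isRegularRing`), `of_X0_sq_mem_nonZeroDivisors`, `root_rel`;
* §2 ring identities, `f_rel_away`, ★ `exists_chartMap` (`φ : C_X → A₀[1/x̄²]`, `x ↦ x̄`, `y′, u′, t′, s′, z′ ↦ ȳ/x̄², ū/x̄², t̄/x̄², s̄/x̄², z̄/x̄²`; one `AdjoinRoot.lift`),
  ★ `exists_blowdownMap` (`ψ₁ : A₀ → C_X`, `x̄, ȳ, ū, t̄, s̄, z̄ ↦ x, x²y′, x²u′, x²t′, x²s′, x²z′`), ★ `chartMap_injective` (`x²` is a non-zero-divisor of the flat `B₀`-algebra `C_X`);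
* §3 ★★ `exists_chartEquiv : ∃ e : C_X ≃+* blowupAlgebra τ (x̄²)` with the generator values; ★★ `cmCl_localization_blowupAlgebra` — CM at EVERY prime of `A₀[τ/x̄²]`.
[cite: GortzWedhorn2020, (13.19) p. 415] [cite: StacksProject, Tag 0804] [cite: Matsumura1987, Thm. 17.8, Thm. 23.3 (context)]
-/

-- single-problem summit: the doubled namespace component is forced
set_option linter.dupNamespace false

noncomputable section

namespace Summit.ResolutionOfSingularities.ResolutionOfSingularities.Theorems.FInjectiveMacaulayfication.TauFloorP2d5CXChart

open MvPolynomial IsLocalization Literature.AlgebraicGeometry.Resolution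
open Summit.ResolutionOfSingularities.ResolutionOfSingularities.Theorems.FInjectiveMacaulayfication
open SliceableCentre

variable (k : Type) [Field k]

/-! ## §1 The monic hypersurface `C_X = k[x, y′, u′, t′, s′][z′]/(g₀)`: free, finite, CM -/

/-- `g₀` is monic. [plumbing] -/
theorem monic_g₀ (g₀ : Polynomial (MvPolynomial (Fin 5) k)) (hg₀ : g₀ = Polynomial.X ^ 2 + (Polynomial.C (X 0 ^ 2) * Polynomial.X + Polynomial.C (X 0 ^ 2 * (X 1 ^ 3 + X 2 ^ 3 + X 3 ^ 3 + X 4 ^ 3)))) : g₀.Monic := by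
  rw [hg₀]
  nontriviality (MvPolynomial (Fin 5) k)
  refine Polynomial.monic_X_pow_add ?_
  refine (Polynomial.degree_add_le _ _).trans_lt ?_
  refine max_lt ((Polynomial.degree_C_mul_X_le _).trans_lt (by exact_mod_cast Nat.lt_succ_self 1)) ?_
  exact (Polynomial.degree_C_le).trans_lt (by exact_mod_cast Nat.succ_pos 1)

/-- `C_X` is free and finite over `B₀ = k[x, y′, u′, t′, s′]`. [Mathlib `AdjoinRoot.powerBasis'`] -/
theorem free_finite (g₀ : Polynomial (MvPolynomial (Fin 5) k)) (hg₀ : g₀ = Polynomial.X ^ 2 + (Polynomial.C (X 0 ^ 2) * Polynomial.X + Polynomial.C (X 0 ^ 2 * (X 1 ^ 3 + X 2 ^ 3 + X 3 ^ 3 + X 4 ^ 3)))) :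
    Module.Free (MvPolynomial (Fin 5) k) (AdjoinRoot g₀) ∧ Module.Finite (MvPolynomial (Fin 5) k) (AdjoinRoot g₀) :=
  ⟨Module.Free.of_basis (AdjoinRoot.powerBasis' (monic_g₀ k g₀ hg₀)).basis, (AdjoinRoot.powerBasis' (monic_g₀ k g₀ hg₀)).finite⟩

/-- ★ **CM at every prime of `C_X`** (free ⇒ flat, finite ⇒ integral over the regular ring `B₀`). [cite: Matsumura1987, Thm. 17.8, Thm. 23.3 (context)] -/
theorem cmCl_localization (g₀ : Polynomial (MvPolynomial (Fin 5) k)) (hg₀ : g₀ = Polynomial.X ^ 2 + (Polynomial.C (X 0 ^ 2) * Polynomial.X + Polynomial.C (X 0 ^ 2 * (X 1 ^ 3 + X 2 ^ 3 + X 3 ^ 3 + X 4 ^ 3))))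
    (Q : Ideal (AdjoinRoot g₀)) [Q.IsPrime] : CMCl (Localization.AtPrime Q) := by
  obtain ⟨hfree, hfin⟩ := free_finite k g₀ hg₀
  haveI : Algebra.IsIntegral (MvPolynomial (Fin 5) k) (AdjoinRoot g₀) := Algebra.IsIntegral.of_finite _ _
  exact FlatIntegralCM.cmCl_localization_of_isRegularRing (A := MvPolynomial (Fin 5) k) Q

/-- `x² = (of X0)²` is a NON-ZERO-DIVISOR of `C_X` (flatness over the domain `B₀`). [folklore] -/
theorem of_X0_sq_mem_nonZeroDivisors (g₀ : Polynomial (MvPolynomial (Fin 5) k)) (hg₀ : g₀ = Polynomial.X ^ 2 + (Polynomial.C (X 0 ^ 2) * Polynomial.X + Polynomial.C (X 0 ^ 2 * (X 1 ^ 3 + X 2 ^ 3 + X 3 ^ 3 + X 4 ^ 3)))) :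
    AdjoinRoot.of g₀ (X 0) ^ 2 ∈ nonZeroDivisors (AdjoinRoot g₀) := by
  obtain ⟨hfree, -⟩ := free_finite k g₀ hg₀
  rw [← map_pow, ← AdjoinRoot.algebraMap_eq]
  exact FlatIntegralCM.mem_nonZeroDivisors_algebraMap_of_flat_of_ne_zero (pow_ne_zero 2 (X_ne_zero 0))

/-- `z′² + x²·z′ + x²(y′³+u′³+t′³+s′³) = 0` in `C_X`. [plumbing] -/
theorem root_rel (g₀ : Polynomial (MvPolynomial (Fin 5) k)) (hg₀ : g₀ = Polynomial.X ^ 2 + (Polynomial.C (X 0 ^ 2) * Polynomial.X + Polynomial.C (X 0 ^ 2 * (X 1 ^ 3 + X 2 ^ 3 + X 3 ^ 3 + X 4 ^ 3)))) :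
    AdjoinRoot.root g₀ ^ 2 + AdjoinRoot.of g₀ (X 0) ^ 2 * AdjoinRoot.root g₀ +
      AdjoinRoot.of g₀ (X 0) ^ 2 * (AdjoinRoot.of g₀ (X 1) ^ 3 + AdjoinRoot.of g₀ (X 2) ^ 3 + AdjoinRoot.of g₀ (X 3) ^ 3 + AdjoinRoot.of g₀ (X 4) ^ 3) = 0 := by
  have h := TauFloorBMonicTower.root_rel_of_eq g₀ _ _ hg₀
  simp only [map_add, map_mul, map_pow] at h
  linear_combination h

/-! ## §2 The chart map, the blow-down map, injectivity -/

/-- `g₀(z·i) = 0` in `A₀[1/x̄²]`: when `z² + x⁴z + y³ + u³ + T³ + s³ = 0` and `x²·i = 1`. [ring identity] -/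
theorem ident_z_x {L : Type} [CommRing L] (x y u T s z i : L) (hF : z ^ 2 + x ^ 4 * z + y ^ 3 + u ^ 3 + T ^ 3 + s ^ 3 = 0) (hxi : x ^ 2 * i = 1) :
    (z * i) ^ 2 + (x ^ 2 * (z * i) + x ^ 2 * ((y * i) ^ 3 + (u * i) ^ 3 + (T * i) ^ 3 + (s * i) ^ 3)) = 0 := by
  linear_combination (i ^ 2) * hF + (i ^ 2 * (y ^ 3 + u ^ 3 + T ^ 3 + s ^ 3) - x ^ 2 * z * i) * hxi

/-- `f(x, x²y′, x²u′, x²t′, x²s′, x²z′) = x⁴·g₀(z′)`. [ring identity] -/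
theorem ident_blowdown_x {T : Type} [CommRing T] (x y u t s z : T)
    (hz : z ^ 2 + x ^ 2 * z + x ^ 2 * (y ^ 3 + u ^ 3 + t ^ 3 + s ^ 3) = 0) :
    (x ^ 2 * z) ^ 2 + x ^ 4 * (x ^ 2 * z) + (x ^ 2 * y) ^ 3 + (x ^ 2 * u) ^ 3 + (x ^ 2 * t) ^ 3 + (x ^ 2 * s) ^ 3 = 0 := by
  linear_combination (x ^ 4) * hz

/-- `f̄ = 0` read in `A₀[1/x̄²]`, expanded. [plumbing] -/
theorem f_rel_away (f : MvPolynomial (Fin 6) k) (hf : f = X 5 ^ 2 + X 0 ^ 4 * X 5 + X 1 ^ 3 + X 2 ^ 3 + X 3 ^ 3 + X 4 ^ 3) :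
    algebraMap (MvPolynomial (Fin 6) k ⧸ Ideal.span {f}) (Localization.Away (Ideal.Quotient.mk (Ideal.span {f}) (X 0) ^ 2 : MvPolynomial (Fin 6) k ⧸ Ideal.span {f})) (Ideal.Quotient.mk (Ideal.span {f}) (X 5)) ^ 2 +
      algebraMap (MvPolynomial (Fin 6) k ⧸ Ideal.span {f}) (Localization.Away (Ideal.Quotient.mk (Ideal.span {f}) (X 0) ^ 2 : MvPolynomial (Fin 6) k ⧸ Ideal.span {f})) (Ideal.Quotient.mk (Ideal.span {f}) (X 0)) ^ 4 *
        algebraMap (MvPolynomial (Fin 6) k ⧸ Ideal.span {f}) (Localization.Away (Ideal.Quotient.mk (Ideal.span {f}) (X 0) ^ 2 : MvPolynomial (Fin 6) k ⧸ Ideal.span {f})) (Ideal.Quotient.mk (Ideal.span {f}) (X 5)) +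
      algebraMap (MvPolynomial (Fin 6) k ⧸ Ideal.span {f}) (Localization.Away (Ideal.Quotient.mk (Ideal.span {f}) (X 0) ^ 2 : MvPolynomial (Fin 6) k ⧸ Ideal.span {f})) (Ideal.Quotient.mk (Ideal.span {f}) (X 1)) ^ 3 +
      algebraMap (MvPolynomial (Fin 6) k ⧸ Ideal.span {f}) (Localization.Away (Ideal.Quotient.mk (Ideal.span {f}) (X 0) ^ 2 : MvPolynomial (Fin 6) k ⧸ Ideal.span {f})) (Ideal.Quotient.mk (Ideal.span {f}) (X 2)) ^ 3 +
      algebraMap (MvPolynomial (Fin 6) k ⧸ Ideal.span {f}) (Localization.Away (Ideal.Quotient.mk (Ideal.span {f}) (X 0) ^ 2 : MvPolynomial (Fin 6) k ⧸ Ideal.span {f})) (Ideal.Quotient.mk (Ideal.span {f}) (X 3)) ^ 3 +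
      algebraMap (MvPolynomial (Fin 6) k ⧸ Ideal.span {f}) (Localization.Away (Ideal.Quotient.mk (Ideal.span {f}) (X 0) ^ 2 : MvPolynomial (Fin 6) k ⧸ Ideal.span {f})) (Ideal.Quotient.mk (Ideal.span {f}) (X 4)) ^ 3 = 0 := by
  have h0 : Ideal.Quotient.mk (Ideal.span {f}) (X 5 ^ 2 + X 0 ^ 4 * X 5 + X 1 ^ 3 + X 2 ^ 3 + X 3 ^ 3 + X 4 ^ 3 : MvPolynomial (Fin 6) k) = 0 := by
    rw [← hf]; exact Ideal.Quotient.eq_zero_iff_mem.mpr (Ideal.mem_span_singleton_self f)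
  have h1 := congrArg (algebraMap (MvPolynomial (Fin 6) k ⧸ Ideal.span {f}) (Localization.Away (Ideal.Quotient.mk (Ideal.span {f}) (X 0) ^ 2 : MvPolynomial (Fin 6) k ⧸ Ideal.span {f}))) h0
  rw [map_zero] at h1
  simpa only [map_add, map_mul, map_pow] using h1

/-- ★ **THE CHART MAP `φ : C_X → A₀[1/x̄²]`** (`x ↦ x̄`, `y′, u′, t′, s′ ↦ ȳ/x̄², ū/x̄², t̄/x̄², s̄/x̄²`, `z′ ↦ z̄/x̄²`): one `AdjoinRoot.lift`. [cite: GortzWedhorn2020, (13.19) p. 415] -/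
theorem exists_chartMap (f : MvPolynomial (Fin 6) k) (hf : f = X 5 ^ 2 + X 0 ^ 4 * X 5 + X 1 ^ 3 + X 2 ^ 3 + X 3 ^ 3 + X 4 ^ 3)
    (g₀ : Polynomial (MvPolynomial (Fin 5) k)) (hg₀ : g₀ = Polynomial.X ^ 2 + (Polynomial.C (X 0 ^ 2) * Polynomial.X + Polynomial.C (X 0 ^ 2 * (X 1 ^ 3 + X 2 ^ 3 + X 3 ^ 3 + X 4 ^ 3)))) :
    ∃ φ : AdjoinRoot g₀ →+* Localization.Away (Ideal.Quotient.mk (Ideal.span {f}) (X 0) ^ 2 : MvPolynomial (Fin 6) k ⧸ Ideal.span {f}),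
      (∀ a : k, φ (AdjoinRoot.of g₀ (C a)) = algebraMap (MvPolynomial (Fin 6) k ⧸ Ideal.span {f}) _ (Ideal.Quotient.mk (Ideal.span {f}) (C a))) ∧
      (∀ i : Fin 5, φ (AdjoinRoot.of g₀ (X i)) =
        ![algebraMap (MvPolynomial (Fin 6) k ⧸ Ideal.span {f}) _ (Ideal.Quotient.mk (Ideal.span {f}) (X 0)), algebraMap (MvPolynomial (Fin 6) k ⧸ Ideal.span {f}) _ (Ideal.Quotient.mk (Ideal.span {f}) (X 1)) * Away.invSelf (Ideal.Quotient.mk (Ideal.span {f}) (X 0) ^ 2), algebraMap (MvPolynomial (Fin 6) k ⧸ Ideal.span {f}) _ (Ideal.Quotient.mk (Ideal.span {f}) (X 2)) * Away.invSelf (Ideal.Quotient.mk (Ideal.span {f}) (X 0) ^ 2),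
          algebraMap (MvPolynomial (Fin 6) k ⧸ Ideal.span {f}) _ (Ideal.Quotient.mk (Ideal.span {f}) (X 3)) * Away.invSelf (Ideal.Quotient.mk (Ideal.span {f}) (X 0) ^ 2), algebraMap (MvPolynomial (Fin 6) k ⧸ Ideal.span {f}) _ (Ideal.Quotient.mk (Ideal.span {f}) (X 4)) * Away.invSelf (Ideal.Quotient.mk (Ideal.span {f}) (X 0) ^ 2)] i) ∧
      φ (AdjoinRoot.root g₀) = algebraMap (MvPolynomial (Fin 6) k ⧸ Ideal.span {f}) _ (Ideal.Quotient.mk (Ideal.span {f}) (X 5)) * Away.invSelf (Ideal.Quotient.mk (Ideal.span {f}) (X 0) ^ 2) := by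
  classical
  let mkA : MvPolynomial (Fin 6) k →+* MvPolynomial (Fin 6) k ⧸ Ideal.span {f} := Ideal.Quotient.mk (Ideal.span {f})
  let L := Localization.Away (mkA (X 0) ^ 2)
  let ι : (MvPolynomial (Fin 6) k ⧸ Ideal.span {f}) →+* L := algebraMap _ _
  let inv : L := Away.invSelf (mkA (X 0) ^ 2)
  have hxi : ι (mkA (X 0)) ^ 2 * inv = 1 := by
    have h := Away.mul_invSelf (S := L) (mkA (X 0) ^ 2)
    rwa [map_pow] at h
  let v : Fin 5 → L := ![ι (mkA (X 0)), ι (mkA (X 1)) * inv, ι (mkA (X 2)) * inv, ι (mkA (X 3)) * inv, ι (mkA (X 4)) * inv]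
  let g : MvPolynomial (Fin 5) k →+* L := eval₂Hom (ι.comp (mkA.comp MvPolynomial.C)) v
  have hgX : ∀ i, g (X i) = v i := fun i => eval₂Hom_X' _ _ i
  have hF := f_rel_away k f hf
  have e1 : Polynomial.eval₂ g (ι (mkA (X 5)) * inv) g₀ = 0 := by
    rw [hg₀]
    simp only [Polynomial.eval₂_add, Polynomial.eval₂_mul, Polynomial.eval₂_pow, Polynomial.eval₂_C, Polynomial.eval₂_X,
      map_add, map_mul, map_pow, hgX]
    exact ident_z_x _ _ _ _ _ _ _ hF hxi
  refine ⟨AdjoinRoot.lift g _ e1, fun a => ?_, fun i => ?_, AdjoinRoot.lift_root e1⟩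
  · rw [AdjoinRoot.lift_of e1]; exact eval₂Hom_C _ _ a
  · rw [AdjoinRoot.lift_of e1, hgX]

/-- ★ **THE BLOW-DOWN MAP `ψ₁ : A₀ → C_X`** (`x̄, ȳ, ū, t̄, s̄, z̄ ↦ x, x²y′, x²u′, x²t′, x²s′, x²z′`): it kills `f` by `ident_blowdown_x`. [folklore] -/
theorem exists_blowdownMap (f : MvPolynomial (Fin 6) k) (hf : f = X 5 ^ 2 + X 0 ^ 4 * X 5 + X 1 ^ 3 + X 2 ^ 3 + X 3 ^ 3 + X 4 ^ 3)
    (g₀ : Polynomial (MvPolynomial (Fin 5) k)) (hg₀ : g₀ = Polynomial.X ^ 2 + (Polynomial.C (X 0 ^ 2) * Polynomial.X + Polynomial.C (X 0 ^ 2 * (X 1 ^ 3 + X 2 ^ 3 + X 3 ^ 3 + X 4 ^ 3)))) :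
    ∃ ψ₁ : (MvPolynomial (Fin 6) k ⧸ Ideal.span {f}) →+* AdjoinRoot g₀,
      (∀ j : Fin 6, ψ₁ (Ideal.Quotient.mk (Ideal.span {f}) (X j)) =
        ![AdjoinRoot.of g₀ (X 0), AdjoinRoot.of g₀ (X 0) ^ 2 * AdjoinRoot.of g₀ (X 1), AdjoinRoot.of g₀ (X 0) ^ 2 * AdjoinRoot.of g₀ (X 2), AdjoinRoot.of g₀ (X 0) ^ 2 * AdjoinRoot.of g₀ (X 3),
          AdjoinRoot.of g₀ (X 0) ^ 2 * AdjoinRoot.of g₀ (X 4), AdjoinRoot.of g₀ (X 0) ^ 2 * AdjoinRoot.root g₀] j) ∧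
      ∀ a : k, ψ₁ (Ideal.Quotient.mk (Ideal.span {f}) (C a)) = AdjoinRoot.of g₀ (C a) := by
  let u : Fin 6 → AdjoinRoot g₀ := ![AdjoinRoot.of g₀ (X 0), AdjoinRoot.of g₀ (X 0) ^ 2 * AdjoinRoot.of g₀ (X 1), AdjoinRoot.of g₀ (X 0) ^ 2 * AdjoinRoot.of g₀ (X 2), AdjoinRoot.of g₀ (X 0) ^ 2 * AdjoinRoot.of g₀ (X 3),
          AdjoinRoot.of g₀ (X 0) ^ 2 * AdjoinRoot.of g₀ (X 4), AdjoinRoot.of g₀ (X 0) ^ 2 * AdjoinRoot.root g₀]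
  have hf0 : eval₂Hom ((AdjoinRoot.of g₀).comp MvPolynomial.C) u f = 0 := by
    rw [hf]
    simp only [map_add, map_mul, map_pow, eval₂Hom_X']
    exact ident_blowdown_x _ _ _ _ _ _ (root_rel k g₀ hg₀)
  refine ⟨Ideal.Quotient.lift (Ideal.span {f}) (eval₂Hom ((AdjoinRoot.of g₀).comp MvPolynomial.C) u) ?_, fun j => ?_, fun a => ?_⟩
  · intro a ha
    obtain ⟨c, rfl⟩ := Ideal.mem_span_singleton.mp ha
    rw [map_mul, hf0, zero_mul]
  · rw [Ideal.Quotient.lift_mk]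
    exact eval₂Hom_X' _ _ j
  · rw [Ideal.Quotient.lift_mk]
    exact eval₂Hom_C _ _ a

set_option maxHeartbeats 800000 in
-- one `IsLocalization` lift + a generator-by-generator comparison of two ring maps out of `C_X`
/-- ★ **The chart map is injective**: the blow-down map extended to `A₀[1/x̄²] → C_X[1/x²]` inverts it after `C_X → C_X[1/x²]`, injective since `x²` is a
non-zero-divisor of `C_X`. [folklore] -/
theorem chartMap_injective (f : MvPolynomial (Fin 6) k) (hf : f = X 5 ^ 2 + X 0 ^ 4 * X 5 + X 1 ^ 3 + X 2 ^ 3 + X 3 ^ 3 + X 4 ^ 3)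
    (g₀ : Polynomial (MvPolynomial (Fin 5) k)) (hg₀ : g₀ = Polynomial.X ^ 2 + (Polynomial.C (X 0 ^ 2) * Polynomial.X + Polynomial.C (X 0 ^ 2 * (X 1 ^ 3 + X 2 ^ 3 + X 3 ^ 3 + X 4 ^ 3))))
    (φ : AdjoinRoot g₀ →+* Localization.Away (Ideal.Quotient.mk (Ideal.span {f}) (X 0) ^ 2 : MvPolynomial (Fin 6) k ⧸ Ideal.span {f}))
    (hφC : ∀ a : k, φ (AdjoinRoot.of g₀ (C a)) = algebraMap (MvPolynomial (Fin 6) k ⧸ Ideal.span {f}) _ (Ideal.Quotient.mk (Ideal.span {f}) (C a)))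
    (hφX : ∀ i : Fin 5, φ (AdjoinRoot.of g₀ (X i)) =
        ![algebraMap (MvPolynomial (Fin 6) k ⧸ Ideal.span {f}) _ (Ideal.Quotient.mk (Ideal.span {f}) (X 0)), algebraMap (MvPolynomial (Fin 6) k ⧸ Ideal.span {f}) _ (Ideal.Quotient.mk (Ideal.span {f}) (X 1)) * Away.invSelf (Ideal.Quotient.mk (Ideal.span {f}) (X 0) ^ 2), algebraMap (MvPolynomial (Fin 6) k ⧸ Ideal.span {f}) _ (Ideal.Quotient.mk (Ideal.span {f}) (X 2)) * Away.invSelf (Ideal.Quotient.mk (Ideal.span {f}) (X 0) ^ 2),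
          algebraMap (MvPolynomial (Fin 6) k ⧸ Ideal.span {f}) _ (Ideal.Quotient.mk (Ideal.span {f}) (X 3)) * Away.invSelf (Ideal.Quotient.mk (Ideal.span {f}) (X 0) ^ 2), algebraMap (MvPolynomial (Fin 6) k ⧸ Ideal.span {f}) _ (Ideal.Quotient.mk (Ideal.span {f}) (X 4)) * Away.invSelf (Ideal.Quotient.mk (Ideal.span {f}) (X 0) ^ 2)] i)
    (hφz : φ (AdjoinRoot.root g₀) = algebraMap (MvPolynomial (Fin 6) k ⧸ Ideal.span {f}) _ (Ideal.Quotient.mk (Ideal.span {f}) (X 5)) * Away.invSelf (Ideal.Quotient.mk (Ideal.span {f}) (X 0) ^ 2)) :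
    Function.Injective φ := by
  classical
  let mkA : MvPolynomial (Fin 6) k →+* MvPolynomial (Fin 6) k ⧸ Ideal.span {f} := Ideal.Quotient.mk (Ideal.span {f})
  let L := Localization.Away (mkA (X 0) ^ 2)
  let ι : (MvPolynomial (Fin 6) k ⧸ Ideal.span {f}) →+* L := algebraMap _ _
  let inv : L := Away.invSelf (mkA (X 0) ^ 2)
  let xT : AdjoinRoot g₀ := AdjoinRoot.of g₀ (X 0)
  have hx2 : xT ^ 2 ∈ nonZeroDivisors (AdjoinRoot g₀) := of_X0_sq_mem_nonZeroDivisors k g₀ hg₀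
  let LT := Localization.Away (xT ^ 2)
  let ιT : AdjoinRoot g₀ →+* LT := algebraMap _ _
  have hιT_inj : Function.Injective ιT :=
    IsLocalization.injective LT (M := Submonoid.powers (xT ^ 2)) ((Submonoid.powers_le (P := nonZeroDivisors _)).mpr hx2)
  obtain ⟨ψ₁, hψX, hψC⟩ := exists_blowdownMap k f hf g₀ hg₀
  have hψx : ψ₁ (mkA (X 0)) = xT := hψX 0
  have hψx2 : ψ₁ (mkA (X 0) ^ 2) = xT ^ 2 := by rw [map_pow, hψx]
  have hunit : IsUnit ((ιT.comp ψ₁) (mkA (X 0) ^ 2)) := by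
    rw [RingHom.comp_apply, hψx2]
    exact IsLocalization.Away.algebraMap_isUnit (xT ^ 2)
  let ψ : L →+* LT := IsLocalization.Away.lift (mkA (X 0) ^ 2) hunit
  have hψι : ∀ a, ψ (ι a) = ιT (ψ₁ a) := fun a => IsLocalization.Away.lift_eq (mkA (X 0) ^ 2) hunit a
  have hψi : ψ inv * ιT (xT ^ 2) = 1 := by
    have h1 : ψ inv * ψ (ι (mkA (X 0) ^ 2)) = 1 := by
      rw [← map_mul, mul_comm, Away.mul_invSelf, map_one]
    rwa [hψι, hψx2] at h1
  have hcan : ∀ c : AdjoinRoot g₀, ιT (xT ^ 2 * c) * ψ inv = ιT c := fun c => by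
    rw [map_mul, mul_comm (ιT (xT ^ 2)), mul_assoc, mul_comm (ιT (xT ^ 2)), hψi, mul_one]
  have hcomp : ψ.comp φ = ιT := by
    refine TauFloorF5YChartAlgebra.adjoinRoot_ringHom_ext (fun r => ?_) ?_
    · have h0 : ((ψ.comp φ).comp (AdjoinRoot.of g₀)) = ιT.comp (AdjoinRoot.of g₀) := by
        refine MvPolynomial.ringHom_ext (fun a => ?_) (fun i => ?_)
        · change ψ (φ (AdjoinRoot.of g₀ (C a))) = ιT (AdjoinRoot.of g₀ (C a))
          rw [hφC, hψι, hψC]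
        · change ψ (φ (AdjoinRoot.of g₀ (X i))) = ιT (AdjoinRoot.of g₀ (X i))
          rw [hφX]
          fin_cases i
          · change ψ (ι (mkA (X 0))) = ιT (AdjoinRoot.of g₀ (X 0))
            rw [hψι, hψx]
          · change ψ (ι (mkA (X 1)) * inv) = ιT (AdjoinRoot.of g₀ (X 1))
            rw [map_mul, hψι, hψX 1]
            exact hcan _
          · change ψ (ι (mkA (X 2)) * inv) = ιT (AdjoinRoot.of g₀ (X 2))
            rw [map_mul, hψι, hψX 2]
            exact hcan _
          · change ψ (ι (mkA (X 3)) * inv) = ιT (AdjoinRoot.of g₀ (X 3))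
            rw [map_mul, hψι, hψX 3]
            exact hcan _
          · change ψ (ι (mkA (X 4)) * inv) = ιT (AdjoinRoot.of g₀ (X 4))
            rw [map_mul, hψι, hψX 4]
            exact hcan _
      exact RingHom.congr_fun h0 r
    · rw [RingHom.comp_apply, hφz, map_mul, hψι, hψX 5]
      exact hcan (AdjoinRoot.root g₀)
  have h2 : Function.Injective (⇑ψ ∘ ⇑φ) := by rw [← RingHom.coe_comp, hcomp]; exact hιT_inj
  exact h2.of_comp

/-! ## §3 ★★ `C_X ≃ A₀[τ/x̄²]`, CM at every prime of `A₀[τ/x̄²]` -/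

set_option maxHeartbeats 1600000 in
-- generator bookkeeping on both sides (as in `TauFloorBTChart.exists_chartEquiv`)
/-- ★★ **`C_X` is the Rees chart `D(x̄²)` of `Bl_τ X`**: `e : C_X ≃+* blowupAlgebra τ (x̄²)` with `x ↦ x̄`, `y′, u′, t′, s′, z′ ↦ ȳ/x̄², ū/x̄², t̄/x̄², s̄/x̄², z̄/x̄²`.
[cite: GortzWedhorn2020, (13.19) p. 415] -/
theorem exists_chartEquiv (f : MvPolynomial (Fin 6) k) (hf : f = X 5 ^ 2 + X 0 ^ 4 * X 5 + X 1 ^ 3 + X 2 ^ 3 + X 3 ^ 3 + X 4 ^ 3)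
    (g₀ : Polynomial (MvPolynomial (Fin 5) k)) (hg₀ : g₀ = Polynomial.X ^ 2 + (Polynomial.C (X 0 ^ 2) * Polynomial.X + Polynomial.C (X 0 ^ 2 * (X 1 ^ 3 + X 2 ^ 3 + X 3 ^ 3 + X 4 ^ 3)))) :
    ∃ e : AdjoinRoot g₀ ≃+* blowupAlgebra (Ideal.span {Ideal.Quotient.mk (Ideal.span {f}) (X 0) ^ 2, Ideal.Quotient.mk (Ideal.span {f}) (X 1), Ideal.Quotient.mk (Ideal.span {f}) (X 2), Ideal.Quotient.mk (Ideal.span {f}) (X 3), Ideal.Quotient.mk (Ideal.span {f}) (X 4), Ideal.Quotient.mk (Ideal.span {f}) (X 5)} : Ideal (MvPolynomial (Fin 6) k ⧸ Ideal.span {f})) (Ideal.Quotient.mk (Ideal.span {f}) (X 0) ^ 2),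
      (∀ a : k, ((e (AdjoinRoot.of g₀ (C a)) : blowupAlgebra _ (Ideal.Quotient.mk (Ideal.span {f}) (X 0) ^ 2)) : Localization.Away (Ideal.Quotient.mk (Ideal.span {f}) (X 0) ^ 2 : MvPolynomial (Fin 6) k ⧸ Ideal.span {f})) = algebraMap (MvPolynomial (Fin 6) k ⧸ Ideal.span {f}) _ (Ideal.Quotient.mk (Ideal.span {f}) (C a))) ∧
      (∀ i : Fin 5, ((e (AdjoinRoot.of g₀ (X i)) : blowupAlgebra _ (Ideal.Quotient.mk (Ideal.span {f}) (X 0) ^ 2)) : Localization.Away (Ideal.Quotient.mk (Ideal.span {f}) (X 0) ^ 2 : MvPolynomial (Fin 6) k ⧸ Ideal.span {f})) =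
        ![algebraMap (MvPolynomial (Fin 6) k ⧸ Ideal.span {f}) _ (Ideal.Quotient.mk (Ideal.span {f}) (X 0)), algebraMap (MvPolynomial (Fin 6) k ⧸ Ideal.span {f}) _ (Ideal.Quotient.mk (Ideal.span {f}) (X 1)) * Away.invSelf (Ideal.Quotient.mk (Ideal.span {f}) (X 0) ^ 2), algebraMap (MvPolynomial (Fin 6) k ⧸ Ideal.span {f}) _ (Ideal.Quotient.mk (Ideal.span {f}) (X 2)) * Away.invSelf (Ideal.Quotient.mk (Ideal.span {f}) (X 0) ^ 2),
          algebraMap (MvPolynomial (Fin 6) k ⧸ Ideal.span {f}) _ (Ideal.Quotient.mk (Ideal.span {f}) (X 3)) * Away.invSelf (Ideal.Quotient.mk (Ideal.span {f}) (X 0) ^ 2), algebraMap (MvPolynomial (Fin 6) k ⧸ Ideal.span {f}) _ (Ideal.Quotient.mk (Ideal.span {f}) (X 4)) * Away.invSelf (Ideal.Quotient.mk (Ideal.span {f}) (X 0) ^ 2)] i) ∧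
      ((e (AdjoinRoot.root g₀) : blowupAlgebra _ (Ideal.Quotient.mk (Ideal.span {f}) (X 0) ^ 2)) : Localization.Away (Ideal.Quotient.mk (Ideal.span {f}) (X 0) ^ 2 : MvPolynomial (Fin 6) k ⧸ Ideal.span {f})) = algebraMap (MvPolynomial (Fin 6) k ⧸ Ideal.span {f}) _ (Ideal.Quotient.mk (Ideal.span {f}) (X 5)) * Away.invSelf (Ideal.Quotient.mk (Ideal.span {f}) (X 0) ^ 2) := by
  classical
  obtain ⟨φ, hφC, hφX, hφz⟩ := exists_chartMap k f hf g₀ hg₀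
  have hinj := chartMap_injective k f hf g₀ hg₀ φ hφC hφX hφz
  obtain ⟨ψ₁, hψX, hψC⟩ := exists_blowdownMap k f hf g₀ hg₀
  let mkA : MvPolynomial (Fin 6) k →+* MvPolynomial (Fin 6) k ⧸ Ideal.span {f} := Ideal.Quotient.mk (Ideal.span {f})
  let τ : Ideal (MvPolynomial (Fin 6) k ⧸ Ideal.span {f}) := Ideal.span {mkA (X 0) ^ 2, mkA (X 1), mkA (X 2), mkA (X 3), mkA (X 4), mkA (X 5)}
  let L := Localization.Away (mkA (X 0) ^ 2)
  let B : Subalgebra (MvPolynomial (Fin 6) k ⧸ Ideal.span {f}) L := blowupAlgebra τ (mkA (X 0) ^ 2)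
  let ι : (MvPolynomial (Fin 6) k ⧸ Ideal.span {f}) →+* L := algebraMap _ _
  let inv : L := Away.invSelf (mkA (X 0) ^ 2)
  have hxi : ι (mkA (X 0)) ^ 2 * inv = 1 := by
    have h := Away.mul_invSelf (S := L) (mkA (X 0) ^ 2)
    rwa [map_pow] at h
  -- (1) `φ ∘ ψ₁ = ι`
  have hcan : ∀ j : Fin 6, ι (mkA (X 0)) ^ 2 * (ι (mkA (X j)) * inv) = ι (mkA (X j)) := fun j => by
    rw [mul_comm, mul_assoc, mul_comm inv, hxi, mul_one]
  have hφψ : φ.comp ψ₁ = ι := by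
    refine Ideal.Quotient.ringHom_ext (MvPolynomial.ringHom_ext (fun a => ?_) (fun j => ?_))
    · change φ (ψ₁ (mkA (C a))) = ι (mkA (C a))
      rw [hψC, hφC]
    · change φ (ψ₁ (mkA (X j))) = ι (mkA (X j))
      rw [hψX]
      fin_cases j
      · exact hφX 0
      · change φ (AdjoinRoot.of g₀ (X 0) ^ 2 * AdjoinRoot.of g₀ (X 1)) = ι (mkA (X 1))
        rw [map_mul, map_pow, hφX 0, hφX 1]; exact hcan 1
      · change φ (AdjoinRoot.of g₀ (X 0) ^ 2 * AdjoinRoot.of g₀ (X 2)) = ι (mkA (X 2))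
        rw [map_mul, map_pow, hφX 0, hφX 2]; exact hcan 2
      · change φ (AdjoinRoot.of g₀ (X 0) ^ 2 * AdjoinRoot.of g₀ (X 3)) = ι (mkA (X 3))
        rw [map_mul, map_pow, hφX 0, hφX 3]; exact hcan 3
      · change φ (AdjoinRoot.of g₀ (X 0) ^ 2 * AdjoinRoot.of g₀ (X 4)) = ι (mkA (X 4))
        rw [map_mul, map_pow, hφX 0, hφX 4]; exact hcan 4
      · change φ (AdjoinRoot.of g₀ (X 0) ^ 2 * AdjoinRoot.root g₀) = ι (mkA (X 5))
        rw [map_mul, map_pow, hφX 0, hφz]; exact hcan 5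
  have hι_mem : ∀ a, ι a ∈ φ.range := fun a => ⟨ψ₁ a, by rw [← RingHom.comp_apply, hφψ]⟩
  -- (2) `range φ ⊆ B`
  have hB₀ : ∀ b : MvPolynomial (Fin 5) k, φ (AdjoinRoot.of g₀ b) ∈ B := by
    intro b
    induction b using MvPolynomial.induction_on with
    | C a => rw [hφC]; exact B.algebraMap_mem _
    | add p q hp hq => rw [map_add, map_add]; exact B.add_mem hp hq
    | mul_X p i hp =>
      rw [map_mul, map_mul]
      refine B.mul_mem hp ?_
      rw [hφX]
      fin_cases i
      · exact B.algebraMap_mem (mkA (X 0))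
      · change ι (mkA (X 1)) * inv ∈ B
        exact div_mem_blowupAlgebra τ (mkA (X 0) ^ 2) (Ideal.subset_span (by simp))
      · change ι (mkA (X 2)) * inv ∈ B
        exact div_mem_blowupAlgebra τ (mkA (X 0) ^ 2) (Ideal.subset_span (by simp))
      · change ι (mkA (X 3)) * inv ∈ B
        exact div_mem_blowupAlgebra τ (mkA (X 0) ^ 2) (Ideal.subset_span (by simp))
      · change ι (mkA (X 4)) * inv ∈ B
        exact div_mem_blowupAlgebra τ (mkA (X 0) ^ 2) (Ideal.subset_span (by simp))
  have hrange_le : ∀ c, φ c ∈ B := by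
    refine TauFloorF5YChartIdent.adjoinRoot_subring_eq_top g₀ (B.toSubring.comap φ) (fun b => hB₀ b) ?_
    change φ (AdjoinRoot.root g₀) ∈ B
    rw [hφz]
    change ι (mkA (X 5)) * inv ∈ B
    exact div_mem_blowupAlgebra τ (mkA (X 0) ^ 2) (Ideal.subset_span (by simp))
  -- (3) `B ⊆ range φ`
  let Rφ : Subalgebra (MvPolynomial (Fin 6) k ⧸ Ideal.span {f}) L :=
    { carrier := φ.range
      mul_mem' := fun ha hb => φ.range.mul_mem ha hb
      one_mem' := φ.range.one_mem
      add_mem' := fun ha hb => φ.range.add_mem ha hb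
      zero_mem' := φ.range.zero_mem
      algebraMap_mem' := fun a => hι_mem a }
  have hgens : blowupAlgebraGens τ (mkA (X 0) ^ 2) ⊆ (Rφ : Set L) := by
    rintro _ ⟨g, hg, rfl⟩
    change ι g * inv ∈ φ.range
    refine Submodule.span_induction (p := fun g _ => ι g * inv ∈ φ.range) ?_ ?_ ?_ ?_ hg
    · intro g hg
      simp only [Set.mem_insert_iff, Set.mem_singleton_iff] at hg
      rcases hg with rfl | rfl | rfl | rfl | rfl | rfl
      · exact ⟨1, by rw [map_one, map_pow ι, hxi]⟩
      · exact ⟨AdjoinRoot.of g₀ (X 1), hφX 1⟩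
      · exact ⟨AdjoinRoot.of g₀ (X 2), hφX 2⟩
      · exact ⟨AdjoinRoot.of g₀ (X 3), hφX 3⟩
      · exact ⟨AdjoinRoot.of g₀ (X 4), hφX 4⟩
      · exact ⟨AdjoinRoot.root g₀, hφz⟩
    · rw [map_zero, zero_mul]; exact φ.range.zero_mem
    · intro a b _ _ ha hb
      rw [map_add, add_mul]; exact φ.range.add_mem ha hb
    · intro r a _ ha
      rw [smul_eq_mul, map_mul, mul_assoc]; exact φ.range.mul_mem (hι_mem r) ha
  have hle_range : B ≤ Rφ := Algebra.adjoin_le hgens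
  -- (4) the equivalence
  have hsurj : Function.Surjective (φ.codRestrict B.toSubring fun c => hrange_le c) := by
    intro b
    obtain ⟨c, hc⟩ := (hle_range b.2 : (b : L) ∈ φ.range)
    exact ⟨c, Subtype.ext hc⟩
  have hinj' : Function.Injective (φ.codRestrict B.toSubring fun c => hrange_le c) := fun a b h =>
    hinj (congrArg Subtype.val h)
  exact ⟨RingEquiv.ofBijective (φ.codRestrict B.toSubring fun c => hrange_le c) ⟨hinj', hsurj⟩, hφC, hφX, hφz⟩

/-- ★★ **CM at every prime of `A₀[τ/x̄²]`** — the free finite `B₀`-algebra `C_X` is CM at every prime (`cmCl_localization`), transported along `C_X ≃+* blowupAlgebra τ (x̄²)`.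
[cite: Matsumura1987, Thm. 17.8, Thm. 23.3 (context)] -/
theorem cmCl_localization_blowupAlgebra (f : MvPolynomial (Fin 6) k) (hf : f = X 5 ^ 2 + X 0 ^ 4 * X 5 + X 1 ^ 3 + X 2 ^ 3 + X 3 ^ 3 + X 4 ^ 3)
    (Q : Ideal (blowupAlgebra (Ideal.span {Ideal.Quotient.mk (Ideal.span {f}) (X 0) ^ 2, Ideal.Quotient.mk (Ideal.span {f}) (X 1), Ideal.Quotient.mk (Ideal.span {f}) (X 2), Ideal.Quotient.mk (Ideal.span {f}) (X 3), Ideal.Quotient.mk (Ideal.span {f}) (X 4), Ideal.Quotient.mk (Ideal.span {f}) (X 5)} :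
      Ideal (MvPolynomial (Fin 6) k ⧸ Ideal.span {f})) (Ideal.Quotient.mk (Ideal.span {f}) (X 0) ^ 2))) [Q.IsPrime] :
    CMCl (Localization.AtPrime Q) := by
  let g₀ : Polynomial (MvPolynomial (Fin 5) k) := Polynomial.X ^ 2 + (Polynomial.C (X 0 ^ 2) * Polynomial.X + Polynomial.C (X 0 ^ 2 * (X 1 ^ 3 + X 2 ^ 3 + X 3 ^ 3 + X 4 ^ 3)))
  obtain ⟨e, -⟩ := exists_chartEquiv k f hf g₀ rfl
  exact ReesChartFacts.transport_cmCl e (fun P _ => cmCl_localization k g₀ rfl P) Q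

end Summit.ResolutionOfSingularities.ResolutionOfSingularities.Theorems.FInjectiveMacaulayfication.TauFloorP2d5CXChart

end
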